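import Mathlib.RingTheory.Polynomial.Pochhammer
import Literature.Combinatorics.Sahi2008.Indicators

/-!
# The representative (falling-factorial) form of Sahi's functional `E_n` — all orders, any real weight

Support file of the master-family programme (crux `NoHeavyLowerTail`, stmt-CriticalPhenomena-4575; cell `prim-masterthm`,
seat P4 "induction on `k` through the FKG-lattice structure", unit `prim-masterthm-p4-g4`).  Vocabulary: the tree's
`sahiE μ n f` (Sahi's `E_n`, defined by the Lieb–Sahi recursion [LiebSahi2021, Prop. 3.3]), `ex`, `setInd`.

THE IDENTITY (it is Sahi's generating function `1 − ∏_ω (1 − Σ_i t_i f_i(ω))^{μ(ω)}` [Sahi2008, eq. (3)] read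
coefficientwise; proved here directly from the recursion, for EVERY real weight `μ` on a finite type — no sign, normalisation
or lattice hypothesis).  For `n ≥ 1` functions `f_0,…,f_{n-1} : α → ℝ`,

  `E_n(f) = (−1)^{n+1} · Σ_{γ : Fin n → α} (∏_i f_i(γ i)) · ∏_{x : α} (μ x)^{(occ γ x)}`,   `(y)^{(m)} = y(y−1)⋯(y−m+1)`,

`occ γ x = #{i : γ i = x}` (`sahiE_eq_repSum`).  For indicator families `f_i = 1_{U_i}` the sum runs over the SYSTEMS OF
REPRESENTATIVES `γ ∈ ∏_i U_i` (`sahiE_setInd_eq_sum_piFinset`): `E_n(1_{U_0},…,1_{U_{n−1}})` is the signed falling-factorial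
count of the choice functions of the family — compare `∏_i μ(U_i) = Σ_{γ ∈ ∏ U_i} ∏_x (μ x)^{occ γ x}` (plain powers).
Proof: the right-hand side satisfies the Lieb–Sahi recursion — putting the new slot at the point `a` multiplies the weight by
`μ(a) − occ γ a`, and `Σ_a g(a)·occ γ a = Σ_i g(γ i)` (`repSum_succ`).

USE (this seat, files `SahiMasterFamilyStrictHierarchy*`): on a law with a few light atoms the formula is an expansion of `E_n` in
the number `r` of distinct representatives, with sign `(−1)^{r+1}`; it yields the strictness of Sahi's hierarchy at every order.
HONEST FRAMING: an exact identity; nothing here bears on the open conjectures `C_n` [Sahi2008, Conj. 5; Kahn2022, Conj. 5].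
-/

namespace Summit.CriticalPhenomena.PercolationContinuityZ3.Theorems

open Finset Function Polynomial
open Literature.Combinatorics.Sahi2008

namespace SahiRepresentativeForm

variable {α : Type*} [Fintype α] [DecidableEq α]

/-! ### Occupation numbers and the representative weight -/

/-- The occupation number of the point `x` under `γ : Fin n → α`: `#{i : γ i = x}`. [this work] -/
def occ {n : ℕ} (γ : Fin n → α) (x : α) : ℕ := (univ.filter fun i => γ i = x).card

omit [Fintype α] in
/-- `occ` as a sum of indicators. [this work] -/
theorem occ_eq_sum {n : ℕ} (γ : Fin n → α) (x : α) : occ γ x = ∑ i, if γ i = x then 1 else 0 := by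
  rw [occ, card_filter]

omit [Fintype α] in
/-- Occupation numbers of `Fin.cons a δ`: the new slot adds one at `a`. [this work] -/
theorem occ_cons {n : ℕ} (a : α) (δ : Fin n → α) (x : α) :
    occ (Fin.cons a δ : Fin (n + 1) → α) x = occ δ x + if a = x then 1 else 0 := by
  rw [occ_eq_sum, occ_eq_sum, Fin.sum_univ_succ, Fin.cons_zero, add_comm]
  simp only [Fin.cons_succ]

omit [Fintype α] in
/-- On `Fin 1`, `occ γ x = [γ 0 = x]`. [this work] -/
theorem occ_fin_one (γ : Fin 1 → α) (x : α) : occ γ x = if γ 0 = x then 1 else 0 := by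
  rw [occ_eq_sum, Fin.sum_univ_one]

/-- The total occupation is the number of slots: `Σ_x occ γ x = n`. [this work] -/
theorem sum_occ {n : ℕ} (γ : Fin n → α) : ∑ x, occ γ x = n := by
  simp only [occ_eq_sum]
  rw [sum_comm]
  simp

/-- `Σ_x g(x)·occ γ x = Σ_i g(γ i)`. [this work] -/
theorem sum_mul_occ {n : ℕ} (γ : Fin n → α) (g : α → ℝ) :
    ∑ x, g x * (occ γ x : ℝ) = ∑ i, g (γ i) := by
  simp only [occ_eq_sum, Nat.cast_sum, Nat.cast_ite, Nat.cast_one, Nat.cast_zero, mul_sum, mul_ite, mul_one,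
    mul_zero]
  rw [sum_comm]
  refine sum_congr rfl fun i _ => ?_
  simp

/-- The representative weight `∏_x (μ x)^{(occ γ x)}` (falling factorials). [this work] -/
noncomputable def repWeight (μ : α → ℝ) {n : ℕ} (γ : Fin n → α) : ℝ :=
  ∏ x, (descPochhammer ℝ (occ γ x)).eval (μ x)

/-- The representative sum `R_n(f) = Σ_γ (∏_i f_i(γ i)) · repWeight μ γ`. [this work] -/
noncomputable def repSum (μ : α → ℝ) (n : ℕ) (f : Fin n → α → ℝ) : ℝ :=
  ∑ γ : Fin n → α, (∏ i, f i (γ i)) * repWeight μ γ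

/-- Adding a slot at `a` multiplies the representative weight by `μ a − occ δ a`. [this work] -/
theorem repWeight_cons (μ : α → ℝ) {n : ℕ} (a : α) (δ : Fin n → α) :
    repWeight μ (Fin.cons a δ : Fin (n + 1) → α) = repWeight μ δ * (μ a - occ δ a) := by
  unfold repWeight
  have h : ∀ x, (descPochhammer ℝ (occ (Fin.cons a δ : Fin (n + 1) → α) x)).eval (μ x) =
      (descPochhammer ℝ (occ δ x)).eval (μ x) * (if a = x then μ x - occ δ x else 1) := by
    intro x
    rw [occ_cons]
    split_ifs with hx
    · subst hx
      rw [descPochhammer_succ_eval]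
    · rw [add_zero, mul_one]
  rw [prod_congr rfl fun x _ => h x, prod_mul_distrib, prod_ite_eq univ a, if_pos (mem_univ a)]

/-- On `Fin 1` the representative weight of `γ` is `μ (γ 0)`. [this work] -/
theorem repWeight_fin_one (μ : α → ℝ) (γ : Fin 1 → α) : repWeight μ γ = μ (γ 0) := by
  unfold repWeight
  have h : ∀ x, (descPochhammer ℝ (occ γ x)).eval (μ x) = if γ 0 = x then μ x else 1 := by
    intro x
    rw [occ_fin_one]
    split_ifs with hx
    · rw [descPochhammer_one, eval_X]
    · rw [descPochhammer_zero, eval_one]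
  rw [prod_congr rfl fun x _ => h x, prod_ite_eq univ (γ 0), if_pos (mem_univ _)]

/-- `R_1(f) = E(f_0)`. [this work] -/
theorem repSum_one (μ : α → ℝ) (f : Fin 1 → α → ℝ) : repSum μ 1 f = ex μ (f 0) := by
  rw [repSum, ex]
  refine Fintype.sum_equiv (Equiv.funUnique (Fin 1) α) _ _ fun γ => ?_
  rw [Fin.prod_univ_one, repWeight_fin_one, Equiv.funUnique_apply]
  simp only [Fin.default_eq_zero]
  ring

omit [DecidableEq α] in
/-- Splitting a sum over `Fin (n+1) → α` along `Fin.cons`. [folklore] -/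
theorem sum_pi_succ {n : ℕ} (F : (Fin (n + 1) → α) → ℝ) :
    ∑ γ : Fin (n + 1) → α, F γ = ∑ a : α, ∑ δ : Fin n → α, F (Fin.cons a δ) := by
  rw [← Fintype.sum_prod_type']
  exact (Fintype.sum_equiv (Fin.consEquiv fun _ => α) (fun p => F (Fin.cons p.1 p.2)) F fun _ => rfl).symm

omit [Fintype α] [DecidableEq α] in
/-- The product of an updated family along `δ`. [this work] -/
theorem prod_update_mul_apply {n : ℕ} (g : Fin n → α → ℝ) (i : Fin n) (h : α → ℝ) (δ : Fin n → α) :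
    ∏ j, (update g i (g i * h)) j (δ j) = (∏ j, g j (δ j)) * h (δ i) := by
  have hfun : ∀ j, (update g i (g i * h)) j (δ j) = update (fun j => g j (δ j)) i (g i (δ i) * h (δ i)) j := by
    intro j
    by_cases hj : j = i
    · subst hj
      simp
    · simp [hj]
  rw [prod_congr rfl (fun j _ => hfun j), prod_update_of_mem (mem_univ i),
    prod_eq_mul_prod_sdiff_singleton_of_mem (mem_univ i) (fun j => g j (δ j))]
  ring

/-- **The representative sum satisfies the Lieb–Sahi recursion** (with the opposite overall sign):
`R_{n+2}(f) = R_{n+1}(tail f)·E(f_0) − Σ_i R_{n+1}(tail f with slot i multiplied by f_0)`. [this work] -/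
theorem repSum_succ (μ : α → ℝ) (n : ℕ) (f : Fin (n + 2) → α → ℝ) :
    repSum μ (n + 2) f = repSum μ (n + 1) (Fin.tail f) * ex μ (f 0) -
      ∑ i : Fin (n + 1), repSum μ (n + 1) (update (Fin.tail f) i (Fin.tail f i * f 0)) := by
  have hcons : ∀ (a : α) (δ : Fin (n + 1) → α),
      (∏ i, f i ((Fin.cons a δ : Fin (n + 2) → α) i)) * repWeight μ (Fin.cons a δ : Fin (n + 2) → α) =
        ((∏ j, Fin.tail f j (δ j)) * repWeight μ δ) * (f 0 a * (μ a - occ δ a)) := by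
    intro a δ
    rw [Fin.prod_univ_succ, Fin.cons_zero, repWeight_cons]
    simp only [Fin.cons_succ, Fin.tail]
    ring
  have hupd : ∀ i : Fin (n + 1), repSum μ (n + 1) (update (Fin.tail f) i (Fin.tail f i * f 0)) =
      ∑ δ : Fin (n + 1) → α, ((∏ j, Fin.tail f j (δ j)) * repWeight μ δ) * f 0 (δ i) := by
    intro i
    unfold repSum
    refine sum_congr rfl fun δ _ => ?_
    rw [prod_update_mul_apply]
    ring
  calc repSum μ (n + 2) f
      = ∑ a, ∑ δ : Fin (n + 1) → α,
          ((∏ j, Fin.tail f j (δ j)) * repWeight μ δ) * (f 0 a * (μ a - occ δ a)) := by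
        unfold repSum
        rw [sum_pi_succ]
        exact sum_congr rfl fun a _ => sum_congr rfl fun δ _ => hcons a δ
    _ = ∑ δ : Fin (n + 1) → α,
          ((∏ j, Fin.tail f j (δ j)) * repWeight μ δ) * (ex μ (f 0) - ∑ i, f 0 (δ i)) := by
        rw [sum_comm]
        refine sum_congr rfl fun δ _ => ?_
        rw [← mul_sum]
        congr 1
        rw [← sum_mul_occ δ (f 0), ex, ← sum_sub_distrib]
        exact sum_congr rfl fun a _ => by ring
    _ = repSum μ (n + 1) (Fin.tail f) * ex μ (f 0) -
          ∑ i : Fin (n + 1), repSum μ (n + 1) (update (Fin.tail f) i (Fin.tail f i * f 0)) := by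
        simp_rw [hupd]
        rw [repSum, sum_mul, sum_comm, ← sum_sub_distrib]
        refine sum_congr rfl fun δ _ => ?_
        rw [mul_sub, mul_sum]

/-- **Representative form of `E_n`**: `E_{n+1}(f) = (−1)^n · R_{n+1}(f)` for every real weight. [this work] -/
theorem sahiE_eq_repSum (μ : α → ℝ) : ∀ (n : ℕ) (f : Fin (n + 1) → α → ℝ),
    sahiE μ (n + 1) f = (-1) ^ n * repSum μ (n + 1) f
  | 0, f => by
    show sahiE μ 1 f = (-1) ^ 0 * repSum μ 1 f
    rw [pow_zero, one_mul, repSum_one]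
    rfl
  | n + 1, f => by
    rw [sahiE_succ_succ, repSum_succ, sahiE_eq_repSum μ n (Fin.tail f)]
    simp_rw [sahiE_eq_repSum μ n]
    rw [← mul_sum, pow_succ]
    ring

/-- The unshifted form: for `n ≥ 1`, `E_n(f) = (−1)^{n+1} R_n(f)`. [this work] -/
theorem sahiE_eq_repSum' (μ : α → ℝ) {n : ℕ} (hn : 1 ≤ n) (f : Fin n → α → ℝ) :
    sahiE μ n f = (-1) ^ (n + 1) * repSum μ n f := by
  obtain ⟨m, rfl⟩ := Nat.exists_eq_add_of_le' hn
  rw [sahiE_eq_repSum, pow_succ, pow_succ]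
  ring

/-! ### Indicator families: the sum over systems of representatives -/

omit [Fintype α] in
/-- For an indicator family the product `∏_i 1_{U_i}(γ i)` is the indicator of `γ ∈ ∏_i U_i`. [this work] -/
theorem prod_setInd_apply {n : ℕ} (U : Fin n → Finset α) (γ : Fin n → α) :
    ∏ i, setInd (U i) (γ i) = if γ ∈ Fintype.piFinset U then 1 else 0 := by
  simp only [setInd, Fintype.mem_piFinset]
  rw [prod_boole]
  simp

/-- **`E_{n+1}` of an indicator family is the signed falling-factorial count of its systems of representatives**:
`E_{n+1}(1_{U_0},…,1_{U_n}) = (−1)^n Σ_{γ ∈ ∏ U_i} ∏_x (μ x)^{(occ γ x)}`. [this work] -/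
theorem sahiE_setInd_eq_sum_piFinset (μ : α → ℝ) (n : ℕ) (U : Fin (n + 1) → Finset α) :
    sahiE μ (n + 1) (fun i => setInd (U i)) = (-1) ^ n * ∑ γ ∈ Fintype.piFinset U, repWeight μ γ := by
  rw [sahiE_eq_repSum, repSum]
  congr 1
  simp_rw [prod_setInd_apply, boole_mul]
  rw [← sum_filter, filter_mem_eq_inter, univ_inter]

/-- A family with an EMPTY member has `E_{n+1} = 0` (no system of representatives). [this work] -/
theorem sahiE_setInd_eq_zero_of_empty (μ : α → ℝ) (n : ℕ) (U : Fin (n + 1) → Finset α) {i : Fin (n + 1)}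
    (hi : U i = ∅) : sahiE μ (n + 1) (fun i => setInd (U i)) = 0 := by
  rw [sahiE_setInd_eq_sum_piFinset]
  have : Fintype.piFinset U = ∅ := Fintype.piFinset_eq_empty.mpr ⟨i, hi⟩
  rw [this, sum_empty, mul_zero]

/-- The same count with plain powers instead of falling factorials is the product of the masses:
`∏_i μ(U_i) = Σ_{γ ∈ ∏ U_i} ∏_x (μ x)^{occ γ x}`. [this work] -/
theorem prod_mass_eq_sum_piFinset (μ : α → ℝ) {n : ℕ} (U : Fin n → Finset α) :
    ∏ i, (∑ x ∈ U i, μ x) = ∑ γ ∈ Fintype.piFinset U, ∏ x, μ x ^ occ γ x := by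
  rw [prod_univ_sum]
  refine sum_congr rfl fun γ _ => ?_
  have : ∀ x, μ x ^ occ γ x = ∏ i, if γ i = x then μ x else 1 := by
    intro x
    rw [occ_eq_sum, prod_ite, prod_const_one, mul_one, prod_const, ← card_filter]
  simp_rw [this]
  rw [prod_comm]
  exact prod_congr rfl fun i _ => by rw [prod_ite_eq univ (γ i), if_pos (mem_univ _)]

end SahiRepresentativeForm

end Summit.CriticalPhenomena.PercolationContinuityZ3.Theorems
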